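import Summits.AtomisticToContinuum.BoseEinsteinCondensation.Theorems.BECCutLineWeakDisorderTwoReplicaTransienceBoundFreeGas
import Summits.AtomisticToContinuum.BoseEinsteinCondensation.Theorems.BECCutLineWeakDisorderTwoReplicaTransienceBoundSandwich
import Summits.AtomisticToContinuum.BoseEinsteinCondensation.Theorems.BECCutLineWeakDisorderTwoReplicaTransienceBoundTracerMeasurable
import HarnessLib

/-!
# Crux `TwoReplicaTransienceBound` (stmt-AtomisticToContinuum-9687): the quenched ENGINE of line
# `SketchIdeator1` is finite per box on every bounded window of polymer lengths

Support file (does not close the item) for the crux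
`Summit.AtomisticToContinuum.BoseEinsteinCondensation.Theses.BECCutLineWeakDisorder.TwoReplicaTransienceBound`
(route `BECCutLineWeakDisorder`, line `SketchIdeator1`, lead c2). The line's one open stub is the engine
`TracerProfileBound` (`Theorems/BECCutLineWeakDisorderDefs.lean`): the quenched participation ratio
`∫ₓg²/∫ₓg` of the passive tracer's survival profile `g = tracer v L T · Y ωb`, integrated against the bath
weight and the slice law, is `≤ C‖Z_T‖₂²` eventually in `n`, uniformly in `T ≥ 1`. Here
(`engine_window_le`, registered toolbox stub `stub_engineWindowBound`): for EVERY `n`, every measurable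
`v ≤ C`, every `L > 0` and every `T ≥ 0` the engine's left-hand side is at most `K · e^{2nCT} · ‖Z_T‖₂²`
with ONE finite `K` — pathwise free sandwich `∫g²/(∫g)² ≤ ∫θ²/(e^{-nCT}∫θ)²` (`stub_tracerSandwich`),
the free tracer IS the one-line partition function (`FreeGas.tracer_free_eq_fkPartition`), Tonelli
`∫ w ∫ₓg dW_n = s(Y)` (`stub_factorisation`, `stub_tracerMeasurable`), and the absolute bound on the free
profile's participation ratio `L³∫θ²/(∫θ)² ≤ C_abs` (`FreeGas.free_ratio_le`). So the v3/v4 engine passes,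
on every window `1 ≤ T ≤ T₁`, the fixed-box test that killed the annealed v1 engine
(`Cruxes/TwoReplicaTransienceBound/Disproof.lean` §Line); its content is the uniformity in `n` (and, per
box, the `T → ∞` tail, `EngineDossier.md` §2c).

Reference: K. L. Chung, Z. Zhao, *From Brownian Motion to Schrödinger's Equation* (1995), §3.2.
[ChungZhao1995]
-/

noncomputable section

namespace Summit.AtomisticToContinuum.BoseEinsteinCondensation.Cruxes.TwoReplicaTransienceBound.FreeGas

open MeasureTheory Filter Set
open scoped ENNReal NNReal Topology
open Literature.MathematicalPhysics.QuantumManyBody.BoseGas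
open Summit.AtomisticToContinuum.BoseEinsteinCondensation.Theorems.CutLineWitness
open Summit.AtomisticToContinuum.BoseEinsteinCondensation.Cruxes.TwoReplicaTransienceBound.TracerDecoupling

variable {n : ℕ}

/-! ### Pathwise: the quenched profile term is at most `K_T · ∫ₓ g` -/

/-- `expNeg` of a finite argument is the real exponential, hence positive with inverse `e^{+a}`.
[folklore] -/
theorem expNeg_ofReal_inv {a : ℝ} (ha : 0 ≤ a) :
    (expNeg (ENNReal.ofReal a))⁻¹ = ENNReal.ofReal (Real.exp a) := by
  rw [expNeg, if_neg ENNReal.ofReal_ne_top, ENNReal.toReal_ofReal ha,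
    ← ENNReal.ofReal_inv_of_pos (Real.exp_pos _), ← Real.exp_neg, neg_neg]

/-- **Pathwise bound on the quenched profile term** for a bounded potential `v ≤ C`: for every slice `Y`,
every bath path `ωb` and `T ≥ 0`,
`∫ₓ g²/∫ₓ g ≤ [∫ₓθ²/(e^{-nCT}∫ₓθ)²] · ∫ₓ g`, `g = tracer v`, `θ = Z^{(1)}_T` the free survival profile
(the free sandwich `stub_tracerSandwich` and `(a/b²)·b = a/b`). [folklore] -/
theorem profileTerm_le {v : ℝ → ℝ≥0∞} {C : ℝ≥0∞} (hC : ∀ r, v r ≤ C) (L T : ℝ) (x₀ : Space)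
    (Y : Config n) (ωb : PathSpace n) :
    (∫⁻ x, tracer v L T x Y ωb ^ 2) / (∫⁻ x, tracer v L T x Y ωb) ≤
      (∫⁻ x, fkPartition (N := 1) (fun _ => 0) L T (fun _ => x) ^ 2) /
          (expNeg (n * C * ENNReal.ofReal T) * ∫⁻ x, fkPartition (N := 1) (fun _ => 0) L T (fun _ => x)) ^ 2 *
        ∫⁻ x, tracer v L T x Y ωb := by
  have _ := x₀
  set G := ∫⁻ x, tracer v L T x Y ωb with hG
  set G2 := ∫⁻ x, tracer v L T x Y ωb ^ 2 with hG2
  set K := (∫⁻ x, fkPartition (N := 1) (fun _ => 0) L T (fun _ => x) ^ 2) /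
      (expNeg (n * C * ENNReal.ofReal T) * ∫⁻ x, fkPartition (N := 1) (fun _ => 0) L T (fun _ => x)) ^ 2
    with hK
  have hsand : G2 / G ^ 2 ≤ K := by
    have h := stub_tracerSandwich n v C hC L T Y ωb
    simp_rw [tracer_free_eq_fkPartition L T _ Y ωb] at h
    exact h
  have hG21 : G2 ≤ G := lintegral_mono fun x => by
    calc tracer v L T x Y ωb ^ 2 = tracer v L T x Y ωb * tracer v L T x Y ωb := sq _
      _ ≤ 1 * tracer v L T x Y ωb := mul_le_mul' (tracer_le_one v L T x Y ωb) le_rfl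
      _ = _ := one_mul _
  rcases eq_or_ne G 0 with hG0 | hG0
  · have hG20 : G2 = 0 := le_antisymm (hG21.trans hG0.le) bot_le
    simp [hG20]
  rcases eq_or_ne G ⊤ with hGt | hGt
  · simp [hGt, ENNReal.div_top]
  have h1 : G2 ≤ K * G ^ 2 := (ENNReal.div_le_iff (pow_ne_zero _ hG0) (ENNReal.pow_ne_top hGt)).1 hsand
  refine ENNReal.div_le_of_le_mul ?_
  calc G2 ≤ K * G ^ 2 := h1
    _ = K * G * G := by ring

/-! ### The quenched engine in a window of polymer lengths, per box -/

/-- **The line's quenched engine is finite per box on every bounded window of polymer lengths**: there is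
ONE finite constant `K` such that for every `n`, every measurable pair potential bounded by `C`, every `L > 0`
and every `T ≥ 0`, the left-hand side of `TracerProfileBound` at `(v, L, n, T)` is at most
`K · e^{2nCT} · ‖Z_T‖₂²` (pathwise free sandwich `profileTerm_le`, Tonelli `∫ w ∫ₓg dW_n = s(Y)`, and the
absolute bound `free_ratio_le` on the free profile's participation ratio). So the v3/v4 engine passes the
fixed-box test that killed the annealed v1 engine (`Disproof.lean` §Line) on every window `1 ≤ T ≤ T₁`; its
content is the uniformity in `n` (and, per box, in `T → ∞`). [folklore] -/
theorem engine_window_le : ∃ K : ℝ≥0∞, K ≠ ⊤ ∧ ∀ (n : ℕ) (v : ℝ → ℝ≥0∞), Measurable v →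
    ∀ C : ℝ≥0, (∀ r, v r ≤ C) → ∀ L : ℝ, 0 < L → ∀ T : ℝ, 0 ≤ T →
      ∫⁻ Y : Config n, ENNReal.ofReal (L ^ 3) *
          ((∫⁻ x, fkPartition v L T (Matrix.vecCons x Y) ^ 2) *
            ∫⁻ ωb, fkWeight v L T Y ωb *
              ((∫⁻ x, tracer v L T x Y ωb ^ 2) / ∫⁻ x, tracer v L T x Y ωb) ∂wienerPaths n) /
            (∫⁻ x, fkPartition v L T (Matrix.vecCons x Y)) ≤
        K * ENNReal.ofReal (Real.exp (2 * n * C * T)) * fkNormSq (N := n + 1) v L T (fun _ => (1 : ℝ≥0∞)) := by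
  obtain ⟨Cf, hCft, hCf⟩ := free_ratio_le
  refine ⟨Cf, hCft, fun n v hv C hC L hL T hT => ?_⟩
  -- the free profile and its participation ratio
  obtain ⟨θ, hθ⟩ : ∃ θ : Space → ℝ≥0∞, ∀ x, θ x = fkPartition (N := 1) (fun _ => 0) L T (fun _ => x) :=
    ⟨_, fun _ => rfl⟩
  set θ₁ := ∫⁻ x, θ x with hθ₁
  set θ₂ := ∫⁻ x, θ x ^ 2 with hθ₂
  have hratio : ENNReal.ofReal (L ^ 3) * θ₂ / θ₁ ^ 2 ≤ Cf := by
    have h := hCf (fun _ => 0) measurable_const L hL T hT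
    simp only [← hθ] at h
    exact h
  -- the killing factor `e = e^{-nCT}` and its inverse square
  set e : ℝ≥0∞ := expNeg (n * (C : ℝ≥0∞) * ENNReal.ofReal T) with he
  have hearg : (n : ℝ≥0∞) * (C : ℝ≥0∞) * ENNReal.ofReal T = ENNReal.ofReal (n * C * T) := by
    rw [ENNReal.ofReal_mul (by positivity), ENNReal.ofReal_mul (Nat.cast_nonneg n)]
    simp
  have heinv : e⁻¹ = ENNReal.ofReal (Real.exp (n * C * T)) := by
    rw [he, hearg, expNeg_ofReal_inv (by positivity)]
  have he0 : e ≠ 0 := fun h0 => by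
    have : e⁻¹ = ⊤ := by rw [h0, ENNReal.inv_zero]
    rw [heinv] at this; exact ENNReal.ofReal_ne_top this
  have het : e ≠ ⊤ := ne_top_of_le_ne_top ENNReal.one_ne_top (expNeg_le_one _)
  have he2 : (e ^ 2)⁻¹ = ENNReal.ofReal (Real.exp (2 * n * C * T)) := by
    rw [ENNReal.inv_pow, heinv, ← ENNReal.ofReal_pow (Real.exp_pos _).le, ← Real.exp_nat_mul]
    congr 1; push_cast; ring_nf
  -- pathwise constant `Kθ = θ₂/(e θ₁)²`
  set Kθ : ℝ≥0∞ := θ₂ / (e * θ₁) ^ 2 with hKθ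
  have hpath : ∀ (Y : Config n) (ωb : PathSpace n),
      (∫⁻ x, tracer v L T x Y ωb ^ 2) / (∫⁻ x, tracer v L T x Y ωb) ≤ Kθ * ∫⁻ x, tracer v L T x Y ωb := by
    intro Y ωb
    have h := profileTerm_le (n := n) (C := (C : ℝ≥0∞)) (fun r => hC r) L T 0 Y ωb
    simp only [← hθ] at h
    exact h
  -- slice by slice: `∫ w P dW ≤ Kθ s(Y)` and the integrand is `≤ L³ Kθ m(Y)`
  have hslice : ∀ Y : Config n, ENNReal.ofReal (L ^ 3) *
      ((∫⁻ x, fkPartition v L T (Matrix.vecCons x Y) ^ 2) *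
        ∫⁻ ωb, fkWeight v L T Y ωb *
          ((∫⁻ x, tracer v L T x Y ωb ^ 2) / ∫⁻ x, tracer v L T x Y ωb) ∂wienerPaths n) /
        (∫⁻ x, fkPartition v L T (Matrix.vecCons x Y)) ≤
      ENNReal.ofReal (L ^ 3) * Kθ * ∫⁻ x, fkPartition v L T (Matrix.vecCons x Y) ^ 2 := by
    intro Y
    set m := ∫⁻ x, fkPartition v L T (Matrix.vecCons x Y) ^ 2 with hm
    set s := ∫⁻ x, fkPartition v L T (Matrix.vecCons x Y) with hs
    -- Tonelli: `∫ w (∫ₓ g) dW = ∫ₓ Z(x::Y) = s`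
    have hmeas : Measurable (Function.uncurry fun (x : Space) (ωb : PathSpace n) =>
        fkWeight v L T Y ωb * tracer v L T x Y ωb) :=
      ((measurable_fkWeight hv L T Y).comp measurable_snd).mul (stub_tracerMeasurable n v hv L T Y)
    have hton : ∫⁻ ωb, fkWeight v L T Y ωb * (∫⁻ x, tracer v L T x Y ωb) ∂wienerPaths n = s := by
      have h1 : ∀ ωb, fkWeight v L T Y ωb * (∫⁻ x, tracer v L T x Y ωb) =
          ∫⁻ x, fkWeight v L T Y ωb * tracer v L T x Y ωb := fun ωb =>
        (lintegral_const_mul' _ _ ((fkWeight_le_one v L T Y ωb).trans_lt ENNReal.one_lt_top).ne).symm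
      simp_rw [h1]
      rw [← lintegral_lintegral_swap hmeas.aemeasurable, hs]
      refine lintegral_congr fun x => ?_
      exact (stub_factorisation n v hv L T x Y).symm
    have hP : ∫⁻ ωb, fkWeight v L T Y ωb *
        ((∫⁻ x, tracer v L T x Y ωb ^ 2) / ∫⁻ x, tracer v L T x Y ωb) ∂wienerPaths n ≤ Kθ * s := by
      calc ∫⁻ ωb, fkWeight v L T Y ωb *
            ((∫⁻ x, tracer v L T x Y ωb ^ 2) / ∫⁻ x, tracer v L T x Y ωb) ∂wienerPaths n
          ≤ ∫⁻ ωb, fkWeight v L T Y ωb * (Kθ * ∫⁻ x, tracer v L T x Y ωb) ∂wienerPaths n :=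
            lintegral_mono fun ωb => mul_le_mul' le_rfl (hpath Y ωb)
        _ = ∫⁻ ωb, Kθ * (fkWeight v L T Y ωb * ∫⁻ x, tracer v L T x Y ωb) ∂wienerPaths n :=
            lintegral_congr fun ωb => by ring
        _ = Kθ * s := by
            rw [lintegral_const_mul'' _ ?_, hton]
            exact ((measurable_fkWeight hv L T Y).mul
              ((stub_tracerMeasurable n v hv L T Y).lintegral_prod_left')).aemeasurable
    calc ENNReal.ofReal (L ^ 3) * (m * ∫⁻ ωb, fkWeight v L T Y ωb *
          ((∫⁻ x, tracer v L T x Y ωb ^ 2) / ∫⁻ x, tracer v L T x Y ωb) ∂wienerPaths n) / s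
        ≤ ENNReal.ofReal (L ^ 3) * (m * (Kθ * s)) / s := by gcongr
      _ = ENNReal.ofReal (L ^ 3) * Kθ * m * s / s := by ring_nf
      _ = ENNReal.ofReal (L ^ 3) * Kθ * m * (s / s) := mul_div_assoc _ _ _
      _ ≤ ENNReal.ofReal (L ^ 3) * Kθ * m * 1 := by gcongr; exact ENNReal.div_self_le_one
      _ = ENNReal.ofReal (L ^ 3) * Kθ * m := mul_one _
  -- integrate in `Y`: `∫ m(Y) dY = ‖Z_T‖₂²`
  have hF : Measurable fun X : Config (n + 1) => fkSemigroup v L T (fun _ => (1 : ℝ≥0∞)) X ^ 2 :=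
    (measurable_fkSemigroup hv L T measurable_const).pow_const 2
  have hmY : Measurable fun Y : Config n => ∫⁻ x, fkPartition v L T (Matrix.vecCons x Y) ^ 2 :=
    (hF.comp measurable_vecCons).lintegral_prod_left'
  have hFub : ∫⁻ Y : Config n, ∫⁻ x, fkPartition v L T (Matrix.vecCons x Y) ^ 2 =
      fkNormSq (N := n + 1) v L T (fun _ => (1 : ℝ≥0∞)) := by
    have hsw : AEMeasurable (Function.uncurry fun (Y : Config n) (x : Space) =>
        fkPartition v L T (Matrix.vecCons x Y) ^ 2) (volume.prod volume) :=
      (hF.comp (measurable_vecCons.comp measurable_swap)).aemeasurable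
    rw [fkNormSq, ← lintegral_lintegral_vecCons hF, lintegral_lintegral_swap hsw]
    rfl
  -- the constant: `L³ Kθ = (L³ θ₂/θ₁²) · e⁻² ≤ Cf · e^{2nCT}`
  have hconst : ENNReal.ofReal (L ^ 3) * Kθ ≤ Cf * ENNReal.ofReal (Real.exp (2 * n * C * T)) := by
    have hsplit : Kθ = θ₂ / θ₁ ^ 2 * (e ^ 2)⁻¹ := by
      rw [hKθ, mul_pow, div_eq_mul_inv, div_eq_mul_inv,
        ENNReal.mul_inv (Or.inl (pow_ne_zero _ he0)) (Or.inl (ENNReal.pow_ne_top het))]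
      ring
    rw [hsplit, ← mul_assoc, ← he2]
    exact mul_le_mul' (by rw [← mul_div_assoc]; exact hratio) le_rfl
  calc _ ≤ ∫⁻ Y : Config n, ENNReal.ofReal (L ^ 3) * Kθ * ∫⁻ x, fkPartition v L T (Matrix.vecCons x Y) ^ 2 :=
        lintegral_mono hslice
    _ = ENNReal.ofReal (L ^ 3) * Kθ * fkNormSq (N := n + 1) v L T (fun _ => (1 : ℝ≥0∞)) := by
        rw [lintegral_const_mul'' _ hmY.aemeasurable, hFub]
    _ ≤ Cf * ENNReal.ofReal (Real.exp (2 * n * C * T)) * fkNormSq (N := n + 1) v L T (fun _ => 1) :=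
        mul_le_mul' hconst le_rfl

end Summit.AtomisticToContinuum.BoseEinsteinCondensation.Cruxes.TwoReplicaTransienceBound.FreeGas

namespace Summit.AtomisticToContinuum.BoseEinsteinCondensation.Cruxes.TwoReplicaTransienceBound.TracerDecoupling

open Literature.MathematicalPhysics.QuantumManyBody.BoseGas

/-- **Registered toolbox stub `stub_engineWindowBound`** (crux stmt-AtomisticToContinuum-9687, line
`SketchIdeator1`): the quenched engine `TracerProfileBound`'s left-hand side is at most `K·e^{2nCT}·‖Z_T‖₂²` for
EVERY `n`, every measurable `v ≤ C`, every `L > 0`, every `T ≥ 0`, with ONE finite `K`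
(`= FreeGas.engine_window_le`). -/
theorem stub_engineWindowBound :
    ∃ K : ENNReal, K ≠ ⊤ ∧ ∀ (n : ℕ) (v : ℝ → ENNReal), Measurable v → ∀ (C : NNReal), (∀ r, v r ≤ C) →
      ∀ (L : ℝ), 0 < L → ∀ (T : ℝ), 0 ≤ T →
        ∫⁻ Y : Config n, ENNReal.ofReal (L ^ 3) *
            ((∫⁻ x, fkPartition v L T (Matrix.vecCons x Y) ^ 2) *
              ∫⁻ ωb, fkWeight v L T Y ωb *
                ((∫⁻ x, tracer v L T x Y ωb ^ 2) / ∫⁻ x, tracer v L T x Y ωb) ∂wienerPaths n) /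
              (∫⁻ x, fkPartition v L T (Matrix.vecCons x Y)) ≤
          K * ENNReal.ofReal (Real.exp (2 * n * C * T)) * @fkNormSq (n + 1) v L T (fun _ => (1 : ENNReal)) :=
  FreeGas.engine_window_le

end Summit.AtomisticToContinuum.BoseEinsteinCondensation.Cruxes.TwoReplicaTransienceBound.TracerDecoupling

end
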